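import Summits.NavierStokesRegularity.NavierStokesRegularity.Theorems.ClockStretchingLawClockCeilingForwardSmallnessWindow
import HarnessLib

/-!
# Route ClockStretchingLaw, crux `ClockCeiling` (stmt-NavierStokesRegularity-10570) — the universal
# LERAY FLOOR of singular Type-I models and the liminf far-past Liouville theorem

Two portrait / reduction clauses of the crux's Type-I ancient class (`IsTypeIAncientMild C u`),
both read off the forward smallness window `stub_forwardSmallnessWindow`
(`ClockStretchingLawClockCeilingForwardSmallnessWindow.lean`), with the UNIVERSAL constant
`ε₀ = 1/(32 C₀)`, `C₀ = oseenSliceConst` — independent of the Type-I constant `C`: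

* `stub_lerayFloorSingular` — every element singular at the space–time origin satisfies
  `√(−t) sup_x ‖u(t, x)‖ > ε₀` at EVERY `t < 0` (Leray's lower bound on the blow-up rate inside
  the ancient class; compare the class-uniform but `C`-dependent clock / frame / vorticity floors
  `stub_uniformClockLaw`, `stub_uniformFrameLaw`, `uniformVorticityFloor` obtained by compactness);
* `stub_liminfFarPastLiouville` — an element with `√(−t)‖u(t,·)‖_∞ ≤ ε₀` along SOME sequence
  `t → −∞` vanishes identically (strictly improves `stub_smallAtMinusInfinityLiouville`, which
  needs smallness on a whole backward end); contrapositive `farPastAmplitudeFloor`: a nonzero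
  element stays above the floor on a whole far end, so `liminf_{t→−∞} √(−t)‖u(t)‖_∞ ≥ ε₀` and no
  blow-down of a nonzero element degenerates at unit scale (`eq_zero_or_farPastAmplitudeFloor`).

## References

* J. Leray, *Sur le mouvement d'un liquide visqueux emplissant l'espace*, Acta Math. 63 (1934),
  §19–20. [Leray1934]
* G. Koch, N. Nadirashvili, G. Seregin, V. Šverák, Acta Math. 203 (2009) = arXiv:0709.3599, §4, §6.
  [KochNadirashviliSereginSverak2009]
-/

noncomputable section

-- the summit and its single sub-problem share the name (CONVENTIONS §1), as in every Theorems file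
set_option linter.dupNamespace false

open MeasureTheory Set Filter Topology
open Literature.Analysis Literature.Analysis.FluidPDE

namespace Summit.NavierStokesRegularity.NavierStokesRegularity.Theorems

/-! ## The Leray floor and the liminf far-past Liouville theorem -/

/-- **The window covers `[t₀, 0)` at the Leray scale.** If `‖u(t₀, ·)‖_∞ ≤ 1/(32 C₀ √(−t₀))` then
`‖u(t, x)‖ ≤ 1/(16 C₀ √(−t₀))` for all `t ∈ [t₀, 0)`: with `m = 1/(32C₀√(−t₀))`,
`16 C₀ m √(t − t₀) = √(t − t₀)/(2√(−t₀)) ≤ 1/2`. [cite: KochNadirashviliSereginSverak2009, §4 p. 8 (arXiv:0709.3599)] -/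
theorem lerayFloor_bound_of_small_slice {C : ℝ} {u : ℝ → EuclideanSpace ℝ (Fin 3) → EuclideanSpace ℝ (Fin 3)}
    (h : IsTypeIAncientMild C u) {t₀ : ℝ} (ht₀ : t₀ < 0)
    (hsmall : ∀ x, 32 * oseenSliceConst (EuclideanSpace ℝ (Fin 3)) * (Real.sqrt (-t₀) * ‖u t₀ x‖) ≤ 1)
    {t : ℝ} (ht₀t : t₀ ≤ t) (ht : t < 0) (x : EuclideanSpace ℝ (Fin 3)) :
    ‖u t x‖ ≤ 2 * (1 / (32 * oseenSliceConst (EuclideanSpace ℝ (Fin 3)) * Real.sqrt (-t₀))) := by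
  have hC₀ : 0 < oseenSliceConst (EuclideanSpace ℝ (Fin 3)) := oseenSliceConst_pos
  have hs₀ : 0 < Real.sqrt (-t₀) := Real.sqrt_pos.2 (by linarith)
  set m : ℝ := 1 / (32 * oseenSliceConst (EuclideanSpace ℝ (Fin 3)) * Real.sqrt (-t₀)) with hm
  have hm0 : 0 < m := by positivity
  have h0 : ∀ y, ‖u t₀ y‖ ≤ m := by
    intro y
    have := hsmall y
    rw [hm, le_div_iff₀ (by positivity)]
    calc ‖u t₀ y‖ * (32 * oseenSliceConst (EuclideanSpace ℝ (Fin 3)) * Real.sqrt (-t₀))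
        = 32 * oseenSliceConst (EuclideanSpace ℝ (Fin 3)) * (Real.sqrt (-t₀) * ‖u t₀ y‖) := by ring
      _ ≤ 1 := this
  have hwin : 16 * oseenSliceConst (EuclideanSpace ℝ (Fin 3)) * m * Real.sqrt (t - t₀) ≤ 1 := by
    have hsq : Real.sqrt (t - t₀) ≤ Real.sqrt (-t₀) := Real.sqrt_le_sqrt (by linarith)
    calc 16 * oseenSliceConst (EuclideanSpace ℝ (Fin 3)) * m * Real.sqrt (t - t₀)
        ≤ 16 * oseenSliceConst (EuclideanSpace ℝ (Fin 3)) * m * Real.sqrt (-t₀) := by gcongr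
      _ = 1 / 2 := by
          rw [hm]
          field_simp
          ring
      _ ≤ 1 := by norm_num
  exact stub_forwardSmallnessWindow C u h t₀ m ht₀ hm0 h0 t ht₀t ht hwin x

/-- **Stub `stub_lerayFloorSingular` — the UNIVERSAL all-time Leray floor of singular Type-I
models.** An element of the Type-I ancient class that is singular at the space–time origin
(unbounded on every backward parabolic cylinder `(−r², 0) × B_r`) has, at EVERY time `t < 0`, a
point with `√(−t)‖u(t, x)‖ > 1/(32 C₀)` — a floor independent of the Type-I constant `C`
(Leray's lower bound on the blow-up rate, run inside the ancient class: a slice below the floor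
at `t₀` would keep `u` bounded by `1/(16C₀√(−t₀))` on `[t₀, 0) × ℝ³`,
`lerayFloor_bound_of_small_slice`). [cite: Leray1934, §19–20] -/
theorem stub_lerayFloorSingular :
    ∀ (C : ℝ) (u : ℝ → EuclideanSpace ℝ (Fin 3) → EuclideanSpace ℝ (Fin 3)), Literature.Analysis.FluidPDE.IsTypeIAncientMild C u → (∀ r > 0, ∀ M : ℝ, ∃ t ∈ Set.Ioo (-(r ^ 2)) (0 : ℝ), ∃ x ∈ Metric.ball (0 : EuclideanSpace ℝ (Fin 3)) r, M < ‖u t x‖) → ∀ t < 0, ∃ x, 1 < 32 * Literature.Analysis.FluidPDE.oseenSliceConst (EuclideanSpace ℝ (Fin 3)) * (Real.sqrt (-t) * ‖u t x‖) := by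
  intro C u h hsing t₀ ht₀
  by_contra hcon
  push Not at hcon
  set r : ℝ := Real.sqrt (-t₀) with hr
  have hr0 : 0 < r := Real.sqrt_pos.2 (by linarith)
  set M : ℝ := 2 * (1 / (32 * oseenSliceConst (EuclideanSpace ℝ (Fin 3)) * Real.sqrt (-t₀)))
  obtain ⟨t, ht, x, -, hMx⟩ := hsing r hr0 M
  have hrsq : -(r ^ 2) = t₀ := by rw [hr, Real.sq_sqrt (by linarith)]; ring
  rw [hrsq] at ht
  exact (not_le.2 hMx) (lerayFloor_bound_of_small_slice h ht₀ hcon ht.1.le ht.2 x)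

/-- **Stub `stub_liminfFarPastLiouville` — the liminf far-past Liouville theorem.** If an element
of the Type-I ancient class is below the Leray floor along SOME sequence of times tending to `−∞`
(`∀ T < 0, ∃ t < T, √(−t)‖u(t, ·)‖_∞ ≤ 1/(32C₀)`), it vanishes identically: a small slice at
`t₁ < T` bounds `u` by `1/(16C₀√(−t₁)) ≤ 1/(16C₀√(−T))` on `[t₁, 0) × ℝ³`, and `T → −∞`.
Strictly stronger than smallness on a whole backward end (`stub_smallAtMinusInfinityLiouville`).
[cite: KochNadirashviliSereginSverak2009, §4 p. 8 and §6 (arXiv:0709.3599)] -/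
theorem stub_liminfFarPastLiouville :
    ∀ (C : ℝ) (u : ℝ → EuclideanSpace ℝ (Fin 3) → EuclideanSpace ℝ (Fin 3)), Literature.Analysis.FluidPDE.IsTypeIAncientMild C u → (∀ T < 0, ∃ t < T, ∀ x, 32 * Literature.Analysis.FluidPDE.oseenSliceConst (EuclideanSpace ℝ (Fin 3)) * (Real.sqrt (-t) * ‖u t x‖) ≤ 1) → ∀ t < 0, ∀ x, u t x = 0 := by
  intro C u h hsmall t ht x
  have hC₀ : 0 < oseenSliceConst (EuclideanSpace ℝ (Fin 3)) := oseenSliceConst_pos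
  -- `‖u t x‖ ≤ 1/(16 C₀ √(−T))` for every `T ≤ t`
  have hbound : ∀ T : ℝ, T ≤ t →
      ‖u t x‖ ≤ 2 * (1 / (32 * oseenSliceConst (EuclideanSpace ℝ (Fin 3)) * Real.sqrt (-T))) := by
    intro T hT
    have hT0 : T < 0 := lt_of_le_of_lt hT ht
    obtain ⟨t₁, ht₁T, hsm⟩ := hsmall T hT0
    have ht₁0 : t₁ < 0 := ht₁T.trans hT0
    refine (lerayFloor_bound_of_small_slice h ht₁0 hsm (ht₁T.le.trans hT) ht x).trans ?_
    have hsT : 0 < Real.sqrt (-T) := Real.sqrt_pos.2 (by linarith)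
    have hsq : Real.sqrt (-T) ≤ Real.sqrt (-t₁) := Real.sqrt_le_sqrt (by linarith)
    gcongr
  -- let `T → −∞`
  rw [← norm_le_zero_iff]
  refine le_of_forall_pos_lt_add fun ε hε => ?_
  rw [zero_add]
  -- choose `T` with `1/(16 C₀ √(−T)) < ε`
  set A : ℝ := 1 / (16 * oseenSliceConst (EuclideanSpace ℝ (Fin 3)) * ε) with hA
  have hA0 : 0 < A := by positivity
  set T : ℝ := min t (-(A + 1) ^ 2) with hT
  have hTt : T ≤ t := min_le_left _ _
  have hTA : Real.sqrt (-T) ≥ A + 1 := by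
    have h1 : -T ≥ (A + 1) ^ 2 := by
      have := min_le_right t (-(A + 1) ^ 2)
      rw [← hT] at this
      linarith
    calc Real.sqrt (-T) ≥ Real.sqrt ((A + 1) ^ 2) := Real.sqrt_le_sqrt h1
      _ = A + 1 := Real.sqrt_sq (by linarith)
  have hsT : 0 < Real.sqrt (-T) := by linarith
  calc ‖u t x‖ ≤ 2 * (1 / (32 * oseenSliceConst (EuclideanSpace ℝ (Fin 3)) * Real.sqrt (-T))) :=
        hbound T hTt
    _ = 1 / (16 * oseenSliceConst (EuclideanSpace ℝ (Fin 3)) * Real.sqrt (-T)) := by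
        field_simp; ring
    _ < 1 / (16 * oseenSliceConst (EuclideanSpace ℝ (Fin 3)) * A) := by
        gcongr
        linarith
    _ = ε := by rw [hA]; field_simp

/-- **The far-past amplitude floor of NONZERO Type-I ancient fields** (contrapositive of
`stub_liminfFarPastLiouville`): a nonzero element of the class stays above the universal Leray
floor on a whole backward end — `∃ T < 0, ∀ t < T, ∃ x, √(−t)‖u(t,x)‖ > 1/(32C₀)`. In particular
every blow-down sequence of a nonzero element is bounded away from zero at unit scale.
[cite: KochNadirashviliSereginSverak2009, §6 (arXiv:0709.3599)] -/
theorem farPastAmplitudeFloor {C : ℝ} {u : ℝ → EuclideanSpace ℝ (Fin 3) → EuclideanSpace ℝ (Fin 3)}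
    (h : IsTypeIAncientMild C u) (hne : ∃ t < 0, ∃ x, u t x ≠ 0) :
    ∃ T < 0, ∀ t < T, ∃ x,
      1 < 32 * oseenSliceConst (EuclideanSpace ℝ (Fin 3)) * (Real.sqrt (-t) * ‖u t x‖) := by
  by_contra hcon
  push Not at hcon
  obtain ⟨t, ht, x, hx⟩ := hne
  exact hx (stub_liminfFarPastLiouville C u h hcon t ht x)

/-- **Singular elements stay above the floor at every time; nonzero elements on a far end; and an
element below the floor along a sequence `t_k → −∞` is zero** — packaged trichotomy-free summary:
for `u ∈ A_C`, either `u ≡ 0` or `liminf_{t → −∞} √(−t)‖u(t)‖_∞ ≥ 1/(32 C₀)`. [folklore] -/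
theorem eq_zero_or_farPastAmplitudeFloor {C : ℝ}
    {u : ℝ → EuclideanSpace ℝ (Fin 3) → EuclideanSpace ℝ (Fin 3)} (h : IsTypeIAncientMild C u) :
    (∀ t < 0, ∀ x, u t x = 0) ∨ ∃ T < 0, ∀ t < T, ∃ x,
      1 < 32 * oseenSliceConst (EuclideanSpace ℝ (Fin 3)) * (Real.sqrt (-t) * ‖u t x‖) := by
  by_cases hz : ∀ t < 0, ∀ x, u t x = 0
  · exact Or.inl hz
  · push Not at hz
    obtain ⟨t, ht, x, hx⟩ := hz
    exact Or.inr (farPastAmplitudeFloor h ⟨t, ht, x, hx⟩)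

/-! ## Quantitative backward persistence of concentration (explicit, C-independent, unlocalised) -/

/-- **Quantitative backward persistence of velocity concentration.** If `√(−t)‖u(t, x)‖ ≥ θ > 0` at
one point, then at every earlier time `Lt`, `L > 1`, the normalised amplitude is not small
somewhere: `√(−Lt) sup_{x'}‖u(Lt, x')‖ > min(√(L/(L−1))/(32C₀), θ√L/4)` — an EXPLICIT threshold
independent of the Type-I constant `C` (the price: no localisation of `x'`; the compactness version
`stub_backwardPersistenceOfConcentration` localises `x'` within `R(C,θ,L)√(−t)` of `x` at the cost of
a non-explicit threshold). Proof: otherwise the forward smallness window from `t₀ = Lt`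
(`stub_forwardSmallnessWindow`, `16C₀m√(t − Lt) ≤ 1/2`) bounds `√(−t)‖u(t, x)‖` by `θ/2`.
[cite: KochNadirashviliSereginSverak2009, §4 p. 8 (arXiv:0709.3599)] -/
theorem backwardPersistence_quantitative {C : ℝ}
    {u : ℝ → EuclideanSpace ℝ (Fin 3) → EuclideanSpace ℝ (Fin 3)} (h : IsTypeIAncientMild C u)
    {t : ℝ} (ht : t < 0) {L : ℝ} (hL : 1 < L) {θ : ℝ} (hθ : 0 < θ) {x : EuclideanSpace ℝ (Fin 3)}
    (hx : θ ≤ Real.sqrt (-t) * ‖u t x‖) :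
    ∃ x', min (Real.sqrt (L / (L - 1)) / (32 * oseenSliceConst (EuclideanSpace ℝ (Fin 3))))
      (θ * Real.sqrt L / 4) < Real.sqrt (-(L * t)) * ‖u (L * t) x'‖ := by
  have hC₀ : 0 < oseenSliceConst (EuclideanSpace ℝ (Fin 3)) := oseenSliceConst_pos
  by_contra hcon
  push Not at hcon
  set μ : ℝ := min (Real.sqrt (L / (L - 1)) / (32 * oseenSliceConst (EuclideanSpace ℝ (Fin 3))))
    (θ * Real.sqrt L / 4) with hμ
  have hL0 : 0 < L := by linarith
  have hL1 : 0 < L - 1 := by linarith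
  have hsL : 0 < Real.sqrt L := Real.sqrt_pos.2 hL0
  have hμ0 : 0 < μ := lt_min (by positivity) (by positivity)
  have hLt : L * t < 0 := mul_neg_of_pos_of_neg hL0 ht
  have hLtt : L * t ≤ t := by nlinarith
  have hsLt : 0 < Real.sqrt (-(L * t)) := Real.sqrt_pos.2 (by linarith)
  -- the small slice at `Lt`
  set m : ℝ := μ / Real.sqrt (-(L * t)) with hm
  have hm0 : 0 < m := div_pos hμ0 hsLt
  have h0 : ∀ y, ‖u (L * t) y‖ ≤ m := by
    intro y
    rw [hm, le_div_iff₀ hsLt, mul_comm]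
    exact hcon y
  -- the window reaches `t`: `16 C₀ m √(t − Lt) ≤ 1`
  have hsqrt_diff : Real.sqrt (t - L * t) = Real.sqrt (L - 1) * Real.sqrt (-t) := by
    rw [← Real.sqrt_mul hL1.le]; congr 1; ring
  have hsqrt_Lt : Real.sqrt (-(L * t)) = Real.sqrt L * Real.sqrt (-t) := by
    rw [← Real.sqrt_mul hL0.le]; congr 1; ring
  have hst : 0 < Real.sqrt (-t) := Real.sqrt_pos.2 (by linarith)
  have hwin : 16 * oseenSliceConst (EuclideanSpace ℝ (Fin 3)) * m * Real.sqrt (t - L * t) ≤ 1 := by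
    have hμle : μ ≤ Real.sqrt (L / (L - 1)) / (32 * oseenSliceConst (EuclideanSpace ℝ (Fin 3))) :=
      min_le_left _ _
    have hratio : Real.sqrt (L / (L - 1)) = Real.sqrt L / Real.sqrt (L - 1) := by
      rw [Real.sqrt_div' L hL1.le]
    have hsL1 : 0 < Real.sqrt (L - 1) := Real.sqrt_pos.2 hL1
    rw [hm, hsqrt_diff, hsqrt_Lt]
    rw [hratio] at hμle
    -- `16 C₀ (μ/(√L√(−t))) √(L−1) √(−t) = 16 C₀ μ √(L−1)/√L ≤ 1/2`
    have e1 : 16 * oseenSliceConst (EuclideanSpace ℝ (Fin 3)) * (μ / (Real.sqrt L * Real.sqrt (-t))) *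
        (Real.sqrt (L - 1) * Real.sqrt (-t)) =
        16 * oseenSliceConst (EuclideanSpace ℝ (Fin 3)) * μ * (Real.sqrt (L - 1) / Real.sqrt L) := by
      field_simp
    rw [e1]
    have hμ' : μ * (Real.sqrt (L - 1) / Real.sqrt L) ≤
        1 / (32 * oseenSliceConst (EuclideanSpace ℝ (Fin 3))) := by
      calc μ * (Real.sqrt (L - 1) / Real.sqrt L)
          ≤ Real.sqrt L / Real.sqrt (L - 1) / (32 * oseenSliceConst (EuclideanSpace ℝ (Fin 3))) *
              (Real.sqrt (L - 1) / Real.sqrt L) :=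
            mul_le_mul_of_nonneg_right hμle (by positivity)
        _ = 1 / (32 * oseenSliceConst (EuclideanSpace ℝ (Fin 3))) := by
            field_simp
    calc 16 * oseenSliceConst (EuclideanSpace ℝ (Fin 3)) * μ * (Real.sqrt (L - 1) / Real.sqrt L)
        = 16 * oseenSliceConst (EuclideanSpace ℝ (Fin 3)) * (μ * (Real.sqrt (L - 1) / Real.sqrt L)) := by ring
      _ ≤ 16 * oseenSliceConst (EuclideanSpace ℝ (Fin 3)) *
          (1 / (32 * oseenSliceConst (EuclideanSpace ℝ (Fin 3)))) :=
          mul_le_mul_of_nonneg_left hμ' (by positivity)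
      _ = 1 / 2 := by field_simp; ring
      _ ≤ 1 := by norm_num
  have hbound := stub_forwardSmallnessWindow C u h (L * t) m hLt hm0 h0 t hLtt ht hwin x
  -- `√(−t)‖u(t,x)‖ ≤ 2μ/√L ≤ θ/2 < θ`
  have hμle2 : μ ≤ θ * Real.sqrt L / 4 := min_le_right _ _
  have key : Real.sqrt (-t) * ‖u t x‖ ≤ θ / 2 := by
    calc Real.sqrt (-t) * ‖u t x‖ ≤ Real.sqrt (-t) * (2 * m) :=
          mul_le_mul_of_nonneg_left hbound hst.le
      _ = 2 * μ / Real.sqrt L := by rw [hm, hsqrt_Lt]; field_simp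
      _ ≤ 2 * (θ * Real.sqrt L / 4) / Real.sqrt L := by gcongr
      _ = θ / 2 := by field_simp; ring
  linarith

/-- **Stub `stub_backwardPersistenceQuantitative` (crux stmt-NavierStokesRegularity-10570, line `registered`):
`backwardPersistence_quantitative` with fully qualified names** — explicit, `C`-independent backward
persistence of velocity concentration. [cite: KochNadirashviliSereginSverak2009, §4 p. 8 (arXiv:0709.3599)] -/
theorem stub_backwardPersistenceQuantitative : ∀ (C : ℝ) (u : ℝ → EuclideanSpace ℝ (Fin 3) → EuclideanSpace ℝ (Fin 3)), Literature.Analysis.FluidPDE.IsTypeIAncientMild C u → ∀ t < 0, ∀ L : ℝ, 1 < L → ∀ θ : ℝ, 0 < θ → ∀ x : EuclideanSpace ℝ (Fin 3), θ ≤ Real.sqrt (-t) * ‖u t x‖ → ∃ x' : EuclideanSpace ℝ (Fin 3), min (Real.sqrt (L / (L - 1)) / (32 * Literature.Analysis.FluidPDE.oseenSliceConst (EuclideanSpace ℝ (Fin 3)))) (θ * Real.sqrt L / 4) < Real.sqrt (-(L * t)) * ‖u (L * t) x'‖ :=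
  fun _ _ h _ ht _ hL _ hθ _ hx => backwardPersistence_quantitative h ht hL hθ hx

end Summit.NavierStokesRegularity.NavierStokesRegularity.Theorems

end
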